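import Literature.AlgebraicGeometry.AbelianSchemes.IsLambdaOfAtSqOfGraphPullback
import Literature.AlgebraicGeometry.AbelianSchemes.IsLambdaOfAtBezout
import Literature.AlgebraicGeometry.AbelianSchemes.PolarizationSymmetricWitness
import Literature.AlgebraicGeometry.Motives.AbelianVarietyPhiThetaFibres
import Literature.AlgebraicGeometry.Motives.AbelianVarietyTorsion
import HarnessLib

/-!
# `[Θ] ∈ 2·NS` from `2N·Θ ∼ [2]^*Θ₀` (`N` odd): the pointwise / Bezout half of [MumfordAV1970] §23 Thm. 3 at `n = 2`,
# and the induced HALVING OF AN `IsLambdaOfAt` WITNESS (`(m²)‾ = Λ(𝒪(Θ)) ⇒ m̄ = Λ(𝒪(Θ₁))`)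

Layer `Literature/AlgebraicGeometry/AbelianVarieties` (§§1–3, namespace `Literature.AlgebraicGeometry.AbelianVarieties`) and
`…/AbelianSchemes` (§4, namespace `Literature.AlgebraicGeometry.AbelianSchemes.AbelianSchemeOver`).  THEOREMS ONLY (no definition,
no named fact, no instance, no notation, no `sorry`).  Cell `hodgecm-mathlib` (D-0151), s224 (V)-UPGRADE road (ii-a″) «theta functions
without theta groups» (author of the road and census B-p03 (g17), memo `B-provers/B-p03/g17/CENSUS-Vup-HalfOfLambda.B-p03g17.md`),
file G3 (author B-p07 (g17), B-plan1 (g16) 07:53:38Z).  Files G1 (`TranslationEigenDivisor`, B-p03) and G2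
(`InvariantDivisorDescentMulTwo`, B-p12) PRODUCE, from «`A[2] ⊆ K(Θ)` + an odd-multiple section», an effective `E ∼ 2N•Θ` and a
`Θ₀` with `[2]^*Θ₀ ∼ E`; THIS file turns that output into the conclusion, and is independent of their bytes.

SETTING.  `A` an abelian variety over an algebraically closed field `K` with `2 ≠ 0`; `[2] = (𝟙_A)²` in the group `Hom_K(A, A)`;
classes in `Ȟ¹(A, 𝒪^×)` (★ `CechPic`), `φ_c(a) = t_a^*c·c⁻¹` (★ `phiPic`, a homomorphism in `a` by the theorem of the square ★
`phiPic_mul'` and in `c` ★ `phiPicAt`); `D_a(Θ) = t_a^*Θ − Θ` (★ `weilDiv`, `[D_a(Θ)] = φ_{[Θ]}(a)` ★ `cechClass_weilDiv_eq_phiPic`).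

* §1 `translation_comp_pow_id` (`t_a ≫ [n] = [n] ≫ t_{aⁿ}`), `phiPic_pullback_pow_id` (`φ_{[n]^*c}(a) = [n]^*φ_c(aⁿ)`),
  **`phiPic_pullback_pow_id_eq_pow`** (`φ_{[n]^*c}(a) = φ_c(a)^{n²}`: `φ_c(aⁿ) = φ_c(a)ⁿ` is translation invariant, so `[n]^*` raises it
  to the `n`-th power, ★ `cechPic_pullback_pow_id_phiPic`) — [MumfordAV1970] §8 (iv).
* §2 **`exists_phiPic_eq_phiPic_sq`** — CLASS FORM OF THE HALVING: if `θ^{2N} = [2]^*θ₀` with `N` odd, then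
  `∃ θ₁, ∀ a, φ_θ(a) = φ_{θ₁}(a)²`.  Proof: `φ_θ(a)^{2N} = φ_{θ₀}(a)⁴` (§1); the homomorphism `a ↦ φ_θ(a)^N·φ_{θ₀}(a)^{−2}` is
  `2`-torsion on the `2`-divisible group `A(K)`, hence trivial (★ `eq_one_of_forall_pow_eq_one_of_isAlgClosed`); with `N = 2k + 1`
  put `θ₁ := θ₀·θ^{−k}` (Bezout `N − 2k = 1`) — [MumfordAV1970] §23 Thm. 3 (p. 231), the NS-class half of its proof.
* §3 **`AbelianVariety.exists_forall_linEquiv_two_smul`** — DIVISOR FORM (the (S3) socket of the road): `[2]^*Θ₀ ∼ (2N)•Θ`, `N` odd ⟹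
  `∃ Θ₁, ∀ a, t_a^*Θ + 2•Θ₁ ∼ Θ + 2•t_a^*Θ₁` («`Λ(Θ) = 2Λ(Θ₁)`», `[Θ] ∈ 2·NS(A)`; `[2]_A = Hom.toSchemeHom ((2 : ℤ) • 𝟙 A)`), and the
  (H2-amp)-ready **`AbelianVariety.exists_linEquiv_two_smul_add_translationInvariant`** (`Θ ∼ 2•Θ₁ + Z₀`, `Z₀` translation invariant —
  the input shape of ★ `IsLambdaOfAt.isAmple_of_linEquiv_smul_add`, B-p12 (g16)).
* §4 **`IsLambdaOfAt.of_sq_of_forall_weilDiv_linEquiv_two_smul`** — HALVING A WITNESS over a geometric point `s` of a reduced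
  locally Noetherian base with a dual pair `(D, hD)`: if `(λ²)‾ = Λ(𝒪(Θ))` at `s` (★ `IsLambdaOfAt s D (lam ^ 2) Θ`) and
  `t_P^*Θ + 2•Θ₁ ∼ Θ + 2•t_P^*Θ₁` for all `P`, then `λ̄ = Λ(𝒪(Θ₁))` at `s` — the slice classes `S_λ(P) = [𝒫|_{A_s × {λ̄(P)}}]` satisfy
  `S_{λ²} = S_λ²` (★ `pullback_sliceAt_detClass_mul_hom`) and are multiplicative in `P` (★ `pullback_sliceAt_mul_detClass`), so
  `P ↦ S_λ(P)·φ_{[Θ₁]}(P)⁻¹` is a `2`-torsion homomorphism on `A_s(Ω)`, trivial by divisibility; then ★ `nonempty_iso_iff_detClass_eq`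
  with ★ `detClass_translationPullback_tensor_dual` (the §4 device of ★ `IsLambdaOfAtSqOfGraphPullback`).

NOT here (by name, for the assembly (H2)/(H2-amp)/(V-wrap) of the memo §1): the production of `E` and `Θ₀` (G1/G2), and the ampleness of
`Θ₁` (B-p12 (g16) H3 `AmplePicZeroTwist`).  HC_CM is proved only modulo the 7 printed citations until rung 0 closes; nothing here is about HC.

## References
* [MumfordAV1970] D. Mumford, *Abelian Varieties* (1970), §8 (iv) (p. 75), §23 Thm. 3 (p. 231).
* [MumfordFogartyKirwan1994] D. Mumford, J. Fogarty, F. Kirwan, *Geometric Invariant Theory*, 3rd ed. (1994), Ch. 6 §2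
  Definitions 6.2–6.3 (p. 120), Prop. 6.10 (p. 121).
-/

set_option autoImplicit false

noncomputable section

set_option backward.isDefEq.respectTransparency false

open CategoryTheory CategoryTheory.Limits AlgebraicGeometry MonoidalCategory CartesianMonoidalCategory
open scoped MonObj

universe u

namespace Literature.AlgebraicGeometry.AbelianVarieties

open Literature.AlgebraicGeometry.Motives Literature.AlgebraicGeometry.Modules

variable {K : Type u} [Field K] (A : AbelianVariety K)

/-! ## §1 `φ` and the multiplication `[n] = (𝟙_A)ⁿ` -/

/-- **`t_a ≫ [n] = [n] ≫ t_{aⁿ}`**: translations and `[n] = (𝟙_A)ⁿ` commute up to raising the point to the `n`-th power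
(`t_a = c_a·𝟙_A` with `c_a` the constant map at `a`; `X ≫ t_b = c_b·X` for every endomorphism `X`; `(c_a·𝟙)ⁿ = c_{aⁿ}·𝟙ⁿ`).
[cite: MumfordAV1970, §8 ((iv), p. 75)] -/
theorem translation_comp_pow_id (a : A.Points K) (n : ℕ) :
    A.translation a ≫ ((𝟙 A.X : A.X ⟶ A.X) ^ n) = ((𝟙 A.X : A.X ⟶ A.X) ^ n) ≫ A.translation (a ^ n) := by
  unfold AbelianVariety.translation
  rw [MonObj.comp_pow, Category.comp_id, mul_pow, MonObj.comp_mul, Category.comp_id, AbelianVariety.comp_toSpecOver_comp,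
    ← MonObj.comp_pow]

/-- **`φ_{[n]^*c}(a) = [n]^*(φ_c(aⁿ))`** (`t_a^*[n]^* = [n]^*t_{aⁿ}^*`, §1). [cite: MumfordAV1970, §8 ((iv), p. 75)] -/
theorem phiPic_pullback_pow_id (c : CechPic A.X.left) (a : A.Points K) (n : ℕ) :
    phiPic A (CechPic.pullback ((𝟙 A.X : A.X ⟶ A.X) ^ n).left c) a =
      CechPic.pullback ((𝟙 A.X : A.X ⟶ A.X) ^ n).left (phiPic A c (a ^ n)) := by
  unfold phiPic
  rw [map_div, ← CechPic.pullback_comp, ← Over.comp_left, translation_comp_pow_id, Over.comp_left, CechPic.pullback_comp]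

/-- **`φ_{[n]^*c}(a) = φ_c(a)^{n²}`** over an algebraically closed field: `φ_c(aⁿ) = φ_c(a)ⁿ` (★ `phiPic_mul'`) is translation
invariant, so `[n]^*` raises it to the `n`-th power (★ `cechPic_pullback_pow_id_phiPic`). [cite: MumfordAV1970, §8 ((iv), p. 75)] -/
theorem phiPic_pullback_pow_id_eq_pow [IsAlgClosed K] (c : CechPic A.X.left) (a : A.Points K) (n : ℕ) :
    phiPic A (CechPic.pullback ((𝟙 A.X : A.X ⟶ A.X) ^ n).left c) a = phiPic A c a ^ (n ^ 2) := by
  rw [phiPic_pullback_pow_id, cechPic_pullback_pow_id_phiPic, ← phiPicHom_apply A A.theoremOfTheSquare_holds c, map_pow,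
    phiPicHom_apply, ← pow_mul, sq]

/-! ## §2 The class form of the halving -/

/-- **`θ^{2N} = [2]^*θ₀` with `N` odd ⟹ `φ_θ = φ_{θ₁}²` for some class `θ₁`** (algebraically closed `K`, `2 ≠ 0` in `K`):
`φ_θ(a)^{2N} = φ_{[2]^*θ₀}(a) = φ_{θ₀}(a)⁴` (§1); `a ↦ φ_θ(a)^N·φ_{θ₀}(a)^{−2}` is a homomorphism (theorem of the square) killed by `2`,
hence trivial on the `2`-divisible `A(K)` (★ `eq_one_of_forall_pow_eq_one_of_isAlgClosed`), i.e. `φ_θ^N = φ_{θ₀}²`; with `N = 2k + 1`,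
`θ₁ := θ₀·θ^{−k}` has `φ_{θ₁}² = φ_{θ₀}²·φ_θ^{−2k} = φ_θ^{N − 2k} = φ_θ`.  The NS-class half of [MumfordAV1970] §23 Thm. 3 at `n = 2`.
[cite: MumfordAV1970, §23 Thm. 3 (p. 231) and §8 ((iv), p. 75)] -/
theorem exists_phiPic_eq_phiPic_sq [IsAlgClosed K] (h2 : (2 : K) ≠ 0) (θ θ₀ : CechPic A.X.left) {N : ℕ} (hN : Odd N)
    (h : θ ^ (2 * N) = CechPic.pullback ((𝟙 A.X : A.X ⟶ A.X) ^ 2).left θ₀) :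
    ∃ θ₁ : CechPic A.X.left, ∀ a : A.Points K, phiPic A θ a = phiPic A θ₁ a ^ 2 := by
  obtain ⟨k, rfl⟩ := hN
  -- `φ_θ(a)^{2N} = φ_{θ₀}(a)^4`
  have h4 : ∀ a : A.Points K, phiPic A θ a ^ (2 * (2 * k + 1)) = phiPic A θ₀ a ^ 4 := fun a => by
    rw [← phiPicAt_apply, ← map_pow, phiPicAt_apply, h, phiPic_pullback_pow_id_eq_pow]
    norm_num
  -- the `2`-torsion homomorphism `a ↦ φ_θ(a)^N · φ_{θ₀}(a)^{-2}`
  set ψ : A.Points K →* CechPic A.X.left :=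
    (phiPicHom A A.theoremOfTheSquare_holds θ) ^ (2 * k + 1) * ((phiPicHom A A.theoremOfTheSquare_holds θ₀) ^ 2)⁻¹ with hψ
  have hψa : ∀ a, ψ a = phiPic A θ a ^ (2 * k + 1) * (phiPic A θ₀ a ^ 2)⁻¹ := fun a => by
    simp only [hψ, MonoidHom.mul_apply, MonoidHom.inv_apply, MonoidHom.pow_apply, phiPicHom_apply]
  have hψ2 : ∀ a, ψ a ^ 2 = 1 := fun a => by
    rw [hψa, mul_pow, ← pow_mul, mul_comm (2 * k + 1) 2, h4 a, inv_pow, ← pow_mul]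
    norm_num
  have h2' : ((2 : ℕ) : K) ≠ 0 := by exact_mod_cast h2
  have hψ1 : ∀ a, ψ a = 1 := eq_one_of_forall_pow_eq_one_of_isAlgClosed A ψ h2' hψ2
  -- `θ₁ := θ₀ · θ^{-k}`
  refine ⟨θ₀ * (θ ^ k)⁻¹, fun a => ?_⟩
  have hN : phiPic A θ a ^ (2 * k + 1) = phiPic A θ₀ a ^ 2 := by
    have := hψ1 a
    rw [hψa, mul_inv_eq_one] at this
    exact this
  rw [phiPic_mul_class, phiPic_inv_class, ← phiPicAt_apply A a (θ ^ k), map_pow, phiPicAt_apply, mul_pow, ← hN, inv_pow,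
    ← pow_mul', pow_succ, mul_right_comm, mul_inv_cancel, one_mul]

/-! ## §3 The divisor form: `Λ(Θ) = 2Λ(Θ₁)`; the decomposition `Θ ∼ 2•Θ₁ + Z₀` with `Z₀` translation invariant -/

/-- `[2]_A = (𝟙_A)²` on underlying schemes (★ `hom_zsmul_id`). [cite: MumfordAV1970, §8 ((iv), p. 75)] -/
theorem toSchemeHom_two_zsmul_id_eq :
    AbelianVariety.Hom.toSchemeHom ((2 : ℤ) • 𝟙 A) = ((𝟙 A.X : A.X ⟶ A.X) ^ 2).left := by
  change ((2 : ℤ) • 𝟙 A).hom.hom.hom.left = _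
  rw [A.hom_zsmul_id]
  exact congrArg CommaMorphism.left (zpow_ofNat (𝟙 A.X) 2)

/-- **[MumfordAV1970] §23 THM. 3 AT `n = 2`, NS FORM — `[2]^*Θ₀ ∼ 2N•Θ` with `N` odd ⟹ `∃ Θ₁, ∀ a, t_a^*Θ + 2•Θ₁ ∼ Θ + 2•t_a^*Θ₁`**
(«`Λ(Θ) = 2Λ(Θ₁)`», i.e. `[Θ] ∈ 2·NS(A)`; algebraically closed `Ω` with `2 ≠ 0`; negation-free spelling).  With G1/G2 of the road
(`A[2] ⊆ K(Θ)` + an odd-multiple section ⟹ such a `Θ₀`) this is (H2) of the census.  §2 through the dictionary `Cl(A) ↪ Ȟ¹(A, 𝒪^×)`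
(★ `cechClass_eq_iff_linEquiv`, ★ `CechPic.exists_cechClass_eq`); `[2]_A` in the ★ Kummer spelling `Hom.toSchemeHom ((2 : ℤ) • 𝟙 A)`
(dominant: ★ `isDominant_toSchemeHom_zsmul_of_ne_zero`). [cite: MumfordAV1970, §23 Thm. 3 (p. 231)] -/
theorem _root_.Literature.AlgebraicGeometry.Motives.AbelianVariety.exists_forall_linEquiv_two_smul [IsAlgClosed K]
    (h2 : (2 : K) ≠ 0) (Θ Θ₀ : CartierDivisor A.X.left) {N : ℕ} (hN : Odd N)
    [IsDominant (AbelianVariety.Hom.toSchemeHom ((2 : ℤ) • 𝟙 A))]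
    (h : (Θ₀.pullback (AbelianVariety.Hom.toSchemeHom ((2 : ℤ) • 𝟙 A))).LinEquiv ((2 * N) • Θ)) :
    ∃ Θ₁ : CartierDivisor A.X.left, ∀ a : A.Points K,
      ((Θ.pullback (A.translation a).left) + 2 • Θ₁).LinEquiv (Θ + 2 • (Θ₁.pullback (A.translation a).left)) := by
  have hc : Θ.cechClass ^ (2 * N) = CechPic.pullback ((𝟙 A.X : A.X ⟶ A.X) ^ 2).left Θ₀.cechClass := by
    rw [← AbelianSchemes.cechClass_smul', ← (CartierDivisor.cechClass_eq_iff_linEquiv _ _).2 h, CartierDivisor.cechClass_pullback,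
      toSchemeHom_two_zsmul_id_eq]
  obtain ⟨θ₁, hθ₁⟩ := exists_phiPic_eq_phiPic_sq A h2 Θ.cechClass Θ₀.cechClass hN hc
  obtain ⟨Θ₁, hΘ₁⟩ := CechPic.exists_cechClass_eq θ₁
  refine ⟨Θ₁, fun a => ?_⟩
  have ha := hθ₁ a
  rw [← hΘ₁, phiPic, phiPic, div_pow, div_eq_div_iff_mul_eq_mul] at ha
  rw [← CartierDivisor.cechClass_eq_iff_linEquiv, CartierDivisor.cechClass_add, CartierDivisor.cechClass_add,
    AbelianSchemes.cechClass_smul', AbelianSchemes.cechClass_smul', CartierDivisor.cechClass_pullback, CartierDivisor.cechClass_pullback,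
    ha, mul_comm]

/-- **The (H2-amp)-READY DECOMPOSITION `Θ ∼ 2•Θ₁ + Z₀` with `Z₀` TRANSLATION INVARIANT** (same hypotheses): the class
`z₀ := [Θ]·[Θ₁]⁻²` satisfies `t_a^*z₀ = φ_Θ(a)·[Θ]·(φ_{Θ₁}(a)·[Θ₁])⁻² = z₀` since `φ_Θ = φ_{Θ₁}²`.  Feed `hlin`/`hN` to ★
`IsLambdaOfAt.isAmple_of_linEquiv_smul_add` (B-p12 (g16) `AmplePicZeroTwist`, `q = 2`) to get `Θ₁` ample when `Θ` is ample and a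
polarisation is around (the (V-wrap) of the road). [cite: MumfordAV1970, §23 Thm. 3 (p. 231) and §8 ((iv), p. 75)] -/
theorem _root_.Literature.AlgebraicGeometry.Motives.AbelianVariety.exists_linEquiv_two_smul_add_translationInvariant
    [IsAlgClosed K] (h2 : (2 : K) ≠ 0) (Θ Θ₀ : CartierDivisor A.X.left) {N : ℕ} (hN : Odd N)
    [IsDominant (AbelianVariety.Hom.toSchemeHom ((2 : ℤ) • 𝟙 A))]
    (h : (Θ₀.pullback (AbelianVariety.Hom.toSchemeHom ((2 : ℤ) • 𝟙 A))).LinEquiv ((2 * N) • Θ)) :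
    ∃ Θ₁ Z₀ : CartierDivisor A.X.left,
      (∀ a : A.Points K, (Z₀.pullback (A.translation a).left).LinEquiv Z₀) ∧ Θ.LinEquiv (2 • Θ₁ + Z₀) ∧
        ∀ a : A.Points K,
          ((Θ.pullback (A.translation a).left) + 2 • Θ₁).LinEquiv (Θ + 2 • (Θ₁.pullback (A.translation a).left)) := by
  have hc : Θ.cechClass ^ (2 * N) = CechPic.pullback ((𝟙 A.X : A.X ⟶ A.X) ^ 2).left Θ₀.cechClass := by
    rw [← AbelianSchemes.cechClass_smul', ← (CartierDivisor.cechClass_eq_iff_linEquiv _ _).2 h, CartierDivisor.cechClass_pullback,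
      toSchemeHom_two_zsmul_id_eq]
  obtain ⟨θ₁, hθ₁⟩ := exists_phiPic_eq_phiPic_sq A h2 Θ.cechClass Θ₀.cechClass hN hc
  obtain ⟨Θ₁, hΘ₁⟩ := CechPic.exists_cechClass_eq θ₁
  obtain ⟨Z₀, hZ₀⟩ := CechPic.exists_cechClass_eq (Θ.cechClass * (Θ₁.cechClass ^ 2)⁻¹)
  have hφ : ∀ a : A.Points K, phiPic A Θ.cechClass a = phiPic A Θ₁.cechClass a ^ 2 := fun a => by rw [hΘ₁]; exact hθ₁ a
  refine ⟨Θ₁, Z₀, fun a => ?_, ?_, fun a => ?_⟩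
  · -- translation invariance of `z₀ = [Θ]·[Θ₁]⁻²`
    rw [← CartierDivisor.cechClass_eq_iff_linEquiv, CartierDivisor.cechClass_pullback, hZ₀, map_mul, map_inv, map_pow,
      pullback_translation_eq_phiPic_mul A Θ.cechClass a, pullback_translation_eq_phiPic_mul A Θ₁.cechClass a, hφ a, mul_pow]
    -- `φ₁² θ · (φ₁² θ₁²)⁻¹ = θ · (θ₁²)⁻¹`
    rw [mul_inv, mul_mul_mul_comm, mul_inv_cancel, one_mul]
  · rw [← CartierDivisor.cechClass_eq_iff_linEquiv, CartierDivisor.cechClass_add, AbelianSchemes.cechClass_smul', hZ₀,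
      mul_left_comm, mul_inv_cancel, mul_one]
  · have ha := hφ a
    rw [phiPic, phiPic, div_pow, div_eq_div_iff_mul_eq_mul] at ha
    rw [← CartierDivisor.cechClass_eq_iff_linEquiv, CartierDivisor.cechClass_add, CartierDivisor.cechClass_add,
      AbelianSchemes.cechClass_smul', AbelianSchemes.cechClass_smul', CartierDivisor.cechClass_pullback,
      CartierDivisor.cechClass_pullback, ha, mul_comm]

end Literature.AlgebraicGeometry.AbelianVarieties

/-! ## §4 Halving an `IsLambdaOfAt` witness -/

namespace Literature.AlgebraicGeometry.AbelianSchemes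

open Literature.AlgebraicGeometry.Motives Literature.AlgebraicGeometry.Modules
  Literature.AlgebraicGeometry.AbelianVarieties

namespace AbelianSchemeOver

variable {S : Scheme.{u}} (A : AbelianSchemeOver S) (D : A.DualPair) {Ω : Type u} [Field Ω] (s : Spec (.of Ω) ⟶ S)

/-- **HALVING A WITNESS: `(λ²)‾ = Λ(𝒪(Θ))` at `s` and `t_P^*Θ + 2•Θ₁ ∼ Θ + 2•t_P^*Θ₁` for all `P` ⟹ `λ̄ = Λ(𝒪(Θ₁))` at `s`** (geometric point
`s` with `Ω` algebraically closed and `2 ≠ 0`, reduced locally Noetherian base, dual pair with the unit hypothesis `hD`, `λ` a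
homomorphism).  The slice classes `S_λ(P) = [𝒫|_{A_s × {λ̄(P)}}]` are multiplicative in `λ` (★ `pullback_sliceAt_detClass_mul_hom`:
`S_{λ²} = S_λ²`) and in `P` (★ `pullback_sliceAt_mul_detClass`), and `S_{λ²}(P) = φ_{[Θ]}(P) = φ_{[Θ₁]}(P)²` (★
`IsLambdaOfAt.pullback_sliceAt_detClass_P`); so `P ↦ S_λ(P)·φ_{[Θ₁]}(P)⁻¹` is a homomorphism killed by `2` on the `2`-divisible `A_s(Ω)`,
hence trivial (★ `eq_one_of_forall_pow_eq_one_of_isAlgClosed`): `S_λ = φ_{[Θ₁]}`, which is `IsLambdaOfAt s D lam Θ₁` (rank-one modules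
are classified by their classes, ★ `detClass_translationPullback_tensor_dual`). [cite: MumfordFogartyKirwan1994, Ch. 6 §2 Definition 6.2–6.3 (p. 120) and Prop. 6.10 (p. 121)]
[cite: MumfordAV1970, §8 ((iv), p. 75) and §23 Thm. 3 (p. 231)] -/
theorem IsLambdaOfAt.of_sq_of_forall_weilDiv_linEquiv_two_smul [IsReduced S] [IsLocallyNoetherian S] [IsAlgClosed Ω]
    (h2 : (2 : Ω) ≠ 0) (hD : Nonempty ((Scheme.Modules.pullback (DualPair.unitHatSlice D)).obj D.P ≅ SheafOfModules.unit _))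
    (lam : A.X ⟶ D.hat.X) [IsMonHom lam] {Θ Θ₁ : CartierDivisor (A.fibre s).toAbelianVariety.X.left}
    (hΘ : A.IsLambdaOfAt s D (lam ^ 2) Θ)
    (hΘ₁ : ∀ P : (A.fibre s).toAbelianVariety.Points Ω,
      ((Θ.pullback ((A.fibre s).toAbelianVariety.translation P).left) + 2 • Θ₁).LinEquiv
        (Θ + 2 • (Θ₁.pullback ((A.fibre s).toAbelianVariety.translation P).left))) :
    A.IsLambdaOfAt s D lam Θ₁ := by
  have hP := HasRank.isFiniteLocallyFree' D.hasRank_one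
  -- `S_λ(P)² = φ_{[Θ₁]}(P)²`
  have hsq : ∀ P : (A.fibre s).toAbelianVariety.Points Ω,
      CechPic.pullback (X := (A.fibre s).toAbelianVariety.X.left) (A.sliceAt s D lam P) (detClass hP) ^ 2 =
        phiPic (A.fibre s).toAbelianVariety Θ₁.cechClass P ^ 2 := by
    intro P
    -- `S_{λ²}(P) = φ_{[Θ]}(P)` (pinned to `A_s`)
    have h1 : CechPic.pullback (X := (A.fibre s).toAbelianVariety.X.left) (A.sliceAt s D (lam ^ 2) P) (detClass hP) =
        phiPic (A.fibre s).toAbelianVariety Θ.cechClass P := by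
      have h := IsLambdaOfAt.pullback_sliceAt_detClass_P A D s hΘ hP P
      rw [Θ.cechClass_pullback] at h
      exact h
    rw [pow_two lam, D.pullback_sliceAt_detClass_mul_hom s lam lam hD P, ← pow_two] at h1
    -- `φ_{[Θ]}(P) = φ_{[Θ₁]}(P)²`
    have h2c := (CartierDivisor.cechClass_eq_iff_linEquiv _ _).2 (hΘ₁ P)
    rw [CartierDivisor.cechClass_add, CartierDivisor.cechClass_add, AbelianSchemes.cechClass_smul', AbelianSchemes.cechClass_smul',
      CartierDivisor.cechClass_pullback, CartierDivisor.cechClass_pullback, mul_comm Θ.cechClass, ← div_eq_div_iff_mul_eq_mul,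
      ← div_pow] at h2c
    rw [h1, phiPic, phiPic, h2c]
  -- the `2`-torsion homomorphism `P ↦ S_λ(P) · φ_{[Θ₁]}(P)⁻¹`
  set R : (A.fibre s).toAbelianVariety.Points Ω →* CechPic (A.fibre s).toAbelianVariety.X.left :=
    MonoidHom.mk'
      (fun P => CechPic.pullback (X := (A.fibre s).toAbelianVariety.X.left) (A.sliceAt s D lam P) (detClass hP) /
        phiPic (A.fibre s).toAbelianVariety Θ₁.cechClass P)
      (by
        intro P Q
        rw [D.pullback_sliceAt_mul_detClass s lam hD P Q, phiPic_mul', mul_div_mul_comm]) with hR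
  have hR2 : ∀ P, R P ^ 2 = 1 := fun P => by
    simp only [hR, MonoidHom.mk'_apply]
    rw [div_pow, hsq P, div_self']
  have h2' : ((2 : ℕ) : Ω) ≠ 0 := by exact_mod_cast h2
  have hR1 : ∀ P, R P = 1 := eq_one_of_forall_pow_eq_one_of_isAlgClosed (A.fibre s).toAbelianVariety R h2' hR2
  -- hence `S_λ(P) = φ_{[Θ₁]}(P)`, i.e. `IsLambdaOfAt s D lam Θ₁`
  intro P
  have main : CechPic.pullback (X := (A.fibre s).toAbelianVariety.X.left) (A.sliceAt s D lam P) (detClass hP) =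
      phiPic (A.fibre s).toAbelianVariety Θ₁.cechClass P := by
    have h := hR1 P
    simp only [hR, MonoidHom.mk'_apply] at h
    exact div_eq_one.1 h
  refine (nonempty_iso_iff_detClass_eq (hasRank_pullback _ D.hasRank_one) (A.hasRank_translateTensorDual s Θ₁ P)
    (hP.pullback _) (HasRank.isFiniteLocallyFree' (A.hasRank_translateTensorDual s Θ₁ P))).2 ?_
  rw [detClass_pullback _ hP, A.detClass_translationPullback_tensor_dual s Θ₁ P (HasRank.isFiniteLocallyFree'
    (A.hasRank_translateTensorDual s Θ₁ P)), main]
  exact div_eq_mul_inv _ _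

end AbelianSchemeOver

end Literature.AlgebraicGeometry.AbelianSchemes

end
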